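import Summits.Ventures.Crystal3D.Theorems.StickyWulffConstantCoaxialWallLawTailResidueMonoCapture
import HarnessLib

/-!
# Stub closer `stub_monoCapture` of the registered skeleton 'CoaxialWallLawCertificates' v3 (crux `CoaxialWallLaw`, stmt-Ventures-19481)

HONEST FRAMING. Venture `Summits/Ventures/Crystal3D` (cell `crystal3d-full`); `--supports` the crux `CoaxialWallLaw` (stmt-Ventures-19481,
`route-Ventures-StickyWulffConstant`), registered line 'CoaxialWallLawCertificates' v3 (cf-p1, 2026-08-29T07:35:12Z; ten stubs, composition
`coaxialWallLaw_of_lensCertificates_mono_explicit`).  Closes the stub `stub_monoCapture : TailResidue.MonoCapture` BY NAME with the tree theorem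
`TailResidue.monoCapture` (…TailResidueMonoCapture, p706299: transport to the payer + decoration lemma with the systems moved to the standard placement of
`CapturedAt` + the canonical lens type).  Standard axioms.  Nothing new is proved here.
-/

namespace Summit.Ventures.Crystal3D.Cruxes.CoaxialWallLaw.Certificates

/-- **Stub closer**: `TailResidue.MonoCapture` — the canonical-typing half of the split T4 (tree theorem `TailResidue.monoCapture`). -/
theorem stub_monoCapture : Summit.Ventures.Crystal3D.Theorems.TailResidue.MonoCapture :=
  Summit.Ventures.Crystal3D.Theorems.TailResidue.monoCapture

end Summit.Ventures.Crystal3D.Cruxes.CoaxialWallLaw.Certificates
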